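import Summits.AtomisticToContinuum.Crystallization.Theorems.FrustratedLawDichotomyStrainedPatchHomSlopeLJAffine2List

/-!
# K1-v2 kernel, TABULATED: the three label-accumulated tensors evaluated ONCE into `3/3⁴/3⁵`-entry tables before the quadratic array is assembled
# (27623 `(H) HomFloor (1/625)`, hcp half; hand-1 g34 FINDING §4)

decomp-a2c hand-1 g34 (crux `AperiodicFrustratedLawGap`, stmt-AtomisticToContinuum-27623).  Kernel-cost device only (values provably equal to
`…Affine2List` / `…Affine2Fast`): `memo3` (a `Fin 3`-indexed table with its three entries `let`-bound), `tabT0/tabW1/tabW2` (the tensors `T0L/W1L/W2L` of the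
shared record list tabulated once), `QarrT/quadVec2T/quadL2T/slopeGsLJA2T/htGsA2T/htCertSideA2T` and the equality chain ★ `htCertSideA2F_eq_T`
(`htCertSideA2F p J c w = htCertSideA2T p J c w`), so that ONE kernel `decide` on the tabulated form certifies the certificate side consumed by
`…HomEntryLeafHTA2F.entryLeafOKHT4A2F_sound`.

Kernel definitions + definitional equalities; 0 sorry; standard axioms; no instances / notation / `#eval`.  `--supports stmt-AtomisticToContinuum-27623`.
-/

noncomputable section

namespace Summit.AtomisticToContinuum.Crystallization.Theorems.FrustratedLawDichotomyStrainedPatchHomEntryLeafHT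

open Literature.Analysis.ValidatedNumerics.Numerics
open Summit.AtomisticToContinuum.Crystallization.Theorems.FrustratedLawDichotomyStrainedPatchHomCurvCentreKit
open Summit.AtomisticToContinuum.Crystallization.Theorems.FrustratedLawDichotomyStrainedPatchHomCurvLJ (curvCheckLJM)
open Summit.AtomisticToContinuum.Crystallization.Theorems.FrustratedLawDichotomyStrainedPatchHomForceJacN (forceJacCheckN)
open Summit.AtomisticToContinuum.Crystallization.Theorems.FrustratedLawDichotomyStrainedPatchHomForceHcp (xiBallOK)
open Summit.AtomisticToContinuum.Crystallization.Theorems.FrustratedLawDichotomyStrainedPatchHomSlopeLJ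
open Summit.AtomisticToContinuum.Crystallization.Theorems.FrustratedLawDichotomyStrainedPatchHomSlopeLJAffine
open Summit.AtomisticToContinuum.Crystallization.Theorems.FrustratedLawDichotomyStrainedPatchHomSlopeLJAffine2Kit

/-- A `Fin 3`-indexed table with its three entries evaluated once. -/
def memo3 {α : Type} (f : Fin 3 → α) : Fin 3 → α :=
  let a0 := f 0
  let a1 := f 1
  let a2 := f 2
  fun i => match i with
    | ⟨0, _⟩ => a0
    | ⟨1, _⟩ => a1
    | _ => a2

/-- `memo3 f = f` pointwise. [formal bookkeeping] -/
theorem memo3_apply {α : Type} (f : Fin 3 → α) (i : Fin 3) : memo3 f i = f i := by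
  fin_cases i <;> rfl

/-- `T0` table. -/
def tabT0 (rs : List LabA2) : Fin 3 → Fin 3 → Fin 3 → FI := memo3 fun k => memo3 fun k' => memo3 fun i => T0L rs k k' i
/-- `W1` table. -/
def tabW1 (rs : List LabA2) : Fin 3 → Fin 3 → Fin 3 → Fin 3 → FI := memo3 fun l => memo3 fun k => memo3 fun k' => memo3 fun i => W1L rs l k k' i
/-- `W2` table. -/
def tabW2 (rs : List LabA2) : Fin 3 → Fin 3 → Fin 3 → Fin 3 → Fin 3 → FI :=
  memo3 fun l => memo3 fun l' => memo3 fun k => memo3 fun k' => memo3 fun i => W2L rs l l' k k' i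

/-- `tabT0 = T0L`. [formal bookkeeping] -/
theorem tabT0_apply (rs : List LabA2) (k k' i : Fin 3) : tabT0 rs k k' i = T0L rs k k' i := by simp only [tabT0, memo3_apply]
/-- `tabW1 = W1L`. [formal bookkeeping] -/
theorem tabW1_apply (rs : List LabA2) (l k k' i : Fin 3) : tabW1 rs l k k' i = W1L rs l k k' i := by simp only [tabW1, memo3_apply]
/-- `tabW2 = W2L`. [formal bookkeeping] -/
theorem tabW2_apply (rs : List LabA2) (l l' k k' i : Fin 3) : tabW2 rs l l' k k' i = W2L rs l l' k k' i := by simp only [tabW2, memo3_apply]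

/-- The quadratic array from the tables. -/
def QarrT (c : (Fin 3 × Fin 3) ⊕ Fin 3 → ℤ) (J : Fin 3 → Fin 3 × Fin 3 → ℤ) (t0 : Fin 3 → Fin 3 → Fin 3 → FI) (w1 : Fin 3 → Fin 3 → Fin 3 → Fin 3 → FI)
    (w2 : Fin 3 → Fin 3 → Fin 3 → Fin 3 → Fin 3 → FI) (i : Fin 3) (a a' : Fin 3 × Fin 3) : FI :=
  (((w2 a.2 a'.2 a.1 a'.1 i).add (sum3 fun k' => (cJ c J k' a').mul (w1 a.2 a.1 k' i))).add
    (sum3 fun k => (cJ c J k a).mul (w1 a'.2 k a'.1 i))).add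
    (sum9 fun k k' => (cJ c J k a).mul ((cJ c J k' a').mul (t0 k k' i)))
/-- `quadVec2` from the tables. -/
def quadVec2T (c w : (Fin 3 × Fin 3) ⊕ Fin 3 → ℤ) (J : Fin 3 → Fin 3 × Fin 3 → ℤ) (rs : List LabA2) (t0 : Fin 3 → Fin 3 → Fin 3 → FI)
    (w1 : Fin 3 → Fin 3 → Fin 3 → Fin 3 → FI) (w2 : Fin 3 → Fin 3 → Fin 3 → Fin 3 → Fin 3 → FI) (i : Fin 3) : ℤ :=
  cdiv (∑ a : Fin 3 × Fin 3, ∑ a' : Fin 3 × Fin 3, cdiv (w (Sum.inl a) * w (Sum.inl a')) SC * (QarrT c J t0 w1 w2 i a a').absHi + resQL c w J rs i) (2 * SC)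
/-- ★ The second-order affine slope constant from the tabulated tensors. -/
def slopeGsLJA2T (c w : (Fin 3 × Fin 3) ⊕ Fin 3 → ℤ) (J : Fin 3 → Fin 3 × Fin 3 → ℤ) (Lc Ln : List (Fin 3 → ℤ)) : ℤ :=
  let rs := recsA2 c w J Lc
  let t0 := tabT0 rs
  let w1 := tabW1 rs
  let w2 := tabW2 rs
  let q0 := quadVec2T c w J rs t0 w1 w2 0
  let q1 := quadVec2T c w J rs t0 w1 w2 1
  let q2 := quadVec2T c w J rs t0 w1 w2 2
  g0LJ c Lc + linLJA c w J Lc + (FI.sqrt ⟨0, cdiv (q0 ^ 2 + q1 ^ 2 + q2 ^ 2) SC⟩).hi + rem3LJ c (hullW J w) Lc + naiSLJ c (hullW J w) Ln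

/-- `slopeGsLJA2T = slopeGsLJA2L`. [formal bookkeeping] -/
theorem slopeGsLJA2T_eq (c w : (Fin 3 × Fin 3) ⊕ Fin 3 → ℤ) (J : Fin 3 → Fin 3 × Fin 3 → ℤ) (Lc Ln : List (Fin 3 → ℤ)) :
    slopeGsLJA2T c w J Lc Ln = slopeGsLJA2L c w J Lc Ln := by
  have hQ : ∀ i a a', QarrT c J (tabT0 (recsA2 c w J Lc)) (tabW1 (recsA2 c w J Lc)) (tabW2 (recsA2 c w J Lc)) i a a' =
      QarrL c J (recsA2 c w J Lc) i a a' := by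
    intro i a a'; simp only [QarrT, QarrL, tabT0_apply, tabW1_apply, tabW2_apply]
  have hV : ∀ i, quadVec2T c w J (recsA2 c w J Lc) (tabT0 (recsA2 c w J Lc)) (tabW1 (recsA2 c w J Lc)) (tabW2 (recsA2 c w J Lc)) i =
      quadVec2L c w J (recsA2 c w J Lc) i := by
    intro i; simp only [quadVec2T, quadVec2L, hQ]
  simp only [slopeGsLJA2T, slopeGsLJA2L, quadL2L, hV, Fin.sum_univ_three]

/-- The chunk slope constant, tabulated form. -/
def htGsA2T (c w : (Fin 3 × Fin 3) ⊕ Fin 3 → ℤ) (J : Fin 3 → Fin 3 × Fin 3 → ℤ) (L : List (Fin 3 → ℤ)) : ℤ :=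
  slopeGsLJA2T c w J (htScA2F c w J L) (htSnA2F c w J L)
/-- `htGsA2T = htGsA2F`. [formal bookkeeping] -/
theorem htGsA2T_eq (c w : (Fin 3 × Fin 3) ⊕ Fin 3 → ℤ) (J : Fin 3 → Fin 3 × Fin 3 → ℤ) (L : List (Fin 3 → ℤ)) : htGsA2T c w J L = htGsA2F c w J L := by
  rw [← htGsA2L_eq]; simp only [htGsA2T, htGsA2L, slopeGsLJA2T_eq]
/-- The fused certificate side, tabulated kernel form. -/
def htCertSideA2T (p : HTCert) (J : Fin 3 → Fin 3 × Fin 3 → ℤ) (c w : (Fin 3 × Fin 3) ⊕ Fin 3 → ℤ) : Bool :=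
  xiBallOK c w && jacOK J w && htROKU c w && htCertOKU p c w &&
    curvCheckLJM c w (htCenU c w) (htNaiU c w) p.D p.lam₁ && forceJacCheckN c w (htFar1U c w) p.lam₂ && forceJacCheckN c w (htFar2U c w) p.lam₃ &&
    (htNaiOKA2F c w J (htNearU c w) && htNaiOKNA c w J (htFar1U c w) && htNaiOKNA c w J (htFar2U c w)) &&
    decide (htGsA2T c w J (htNearU c w) + htGsNA c w J (htFar1U c w) + htGsNA c w J (htFar2U c w) ≤ p.Gs)
/-- ★ `htCertSideA2F = htCertSideA2T`. [formal bookkeeping] -/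
theorem htCertSideA2F_eq_T (p : HTCert) (J : Fin 3 → Fin 3 × Fin 3 → ℤ) (c w : (Fin 3 × Fin 3) ⊕ Fin 3 → ℤ) :
    htCertSideA2F p J c w = htCertSideA2T p J c w := by
  simp only [htCertSideA2F, htCertSideA2T, htGsA2T_eq]

end Summit.AtomisticToContinuum.Crystallization.Theorems.FrustratedLawDichotomyStrainedPatchHomEntryLeafHT

end
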